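import Mathlib
import Literature.Probability.Percolation.PercolationProofs
import Literature.Probability.LatticeModels.ProdBernoulliIndependence
import Literature.Probability.LatticeModels.ProdBernoulliClusterLocality
import HarnessLib

/-! # Crux `PercNearOneGluing.AdditiveGluing` (stmt-CriticalPhenomena-4576), line
`sigma-recursion-lemma5-any-relay` — stub `stub_sigmaLaw`

Helper file for the crux skeleton
`Cruxes/AdditiveGluing/Lines/sigma-recursion-lemma5-any-relay.lean` (lead
prover-line-stmt-CriticalPhenomena-4576-0).  Proves exactly the registered stub signature
`stub_sigmaLaw`; lands with `--supports stmt-CriticalPhenomena-4576`.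

## Content

The LAW of the layer decomposition used by the Kozma–Nitzan σ-recursion (arXiv:2401.12397,
§3.2): product-measure calculus on the finite configuration space
`BondConfig (Fin n) = Set (Sym2 (Fin n))`.  With `μ := prodBernoulli (glue w O)`
(`glue w O e = if (∀ x ∈ e, x ∈ O) ∧ ¬ e.IsDiag then 1 else w e`, the observer block `O`
contracted), the layer event `L_S := {ω | ∀ x, x ∈ S ↔ (x ∉ O ∧ ∃ o ∈ O, s(o, x) ∈ ω)}` is
determined by the pairs MEETING `O`, while the glued off-block configuration
`Ψ_S ω := {e | e ∈ ω ∧ ∀ x ∈ e, x ∉ O} ∪ {e | (∀ x ∈ e, x ∈ S) ∧ ¬ e.IsDiag}` is a function of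
the pairs AVOIDING `O`; so `μ (L_S ∩ Ψ_S⁻¹ E) = μ L_S · μ (Ψ_S⁻¹ E)`
(`prodBernoulli_real_inter_of_determinedBy`).  Moreover the push-forward of `μ` under `Ψ_S` is
exactly `μ' := prodBernoulli (glue (kill w O) S)` (`kill w O e = if (∃ x ∈ e, x ∈ O) then 0 else
w e`): `Ψ_S` acts coordinatewise (`e ∈ Ψ_S ω ↔ φ_e (e ∈ ω)` with `φ_e : Prop → Prop`), and a
coordinatewise map of a product of Bernoulli laws is the product of the mapped Bernoulli laws
(Mathlib's `Measure.infinitePi_map_pi` and `ProbabilityTheory.map_bernoulliMeasure`); the three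
kinds of coordinates are: non-loop pairs inside `S` (`φ_e ≡ True`, weight `1`), other pairs
meeting `O` (`φ_e ≡ False`, weight `0`), pairs avoiding `O` (`φ_e = id`, weight `w e`).
Hence `μ (L_S ∩ Ψ_S⁻¹ E) = μ L_S · μ' E` for every event `E`, with no disjointness hypothesis
on `O, S`.  [folklore; Grimmett 1999 §1.3, §2.2]
-/

namespace Summit.CriticalPhenomena.PercolationContinuityZ3.Theorems

open MeasureTheory Set
open Literature.Probability.LatticeModels (prodBernoulli)
open Literature.Probability.Percolation (BondConfig openConn openGraph)

noncomputable section
open Classical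

section CoordinatewiseMap

open ProbabilityTheory
open Literature.Probability.LatticeModels (prodBernoulli_eq_map)

variable {ι : Type*}

/-- **Coordinatewise maps of product Bernoulli measures.**  If `φ i : Prop → Prop` pushes the
coin `Ber(True, False, p i)` to the coin `Ber(True, False, q i)` for every coordinate `i`, then
the coordinatewise map `ω ↦ {i | φ i (i ∈ ω)}` pushes `prodBernoulli p` to `prodBernoulli q`
(transport of Mathlib's `Measure.infinitePi_map_pi` along `setOf : (ι → Prop) ≃ᵐ Set ι`).
[folklore; Grimmett 1999 §1.3 p. 10] -/
theorem sigmaLaw_prodBernoulli_map_coordwise (p q : ι → unitInterval) (φ : ι → Prop → Prop)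
    (h : ∀ i, (Ber(True, False, p i)).map (φ i) = Ber(True, False, q i)) :
    (prodBernoulli p).map (fun ω : Set ι => {i | φ i (i ∈ ω)}) = prodBernoulli q := by
  have hmeas : Measurable fun ω : Set ι => {i | φ i (i ∈ ω)} :=
    measurable_set_iff.2 fun i => (Measurable.of_discrete (f := φ i)).comp (measurable_set_mem i)
  have hΦ : Measurable fun (χ : ι → Prop) (i : ι) => φ i (χ i) :=
    measurable_pi_lambda _ fun i => (Measurable.of_discrete (f := φ i)).comp (measurable_pi_apply i)
  have hcomm : (fun ω : Set ι => {i | φ i (i ∈ ω)}) ∘ (fun χ : ι → Prop => {i | χ i}) =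
      (fun χ : ι → Prop => {i | χ i}) ∘ (fun (χ : ι → Prop) (i : ι) => φ i (χ i)) := rfl
  have hp : prodBernoulli p =
      (Measure.infinitePi fun i => Ber(True, False, p i)).map (fun χ : ι → Prop => {i | χ i}) :=
    prodBernoulli_eq_map p
  have hq : prodBernoulli q =
      (Measure.infinitePi fun i => Ber(True, False, q i)).map (fun χ : ι → Prop => {i | χ i}) :=
    prodBernoulli_eq_map q
  rw [hp, hq, Measure.map_map hmeas measurable_setOf, hcomm, ← Measure.map_map measurable_setOf hΦ,
    Measure.infinitePi_map_pi (fun i => Ber(True, False, p i))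
      (fun i => Measurable.of_discrete (f := φ i))]
  simp only [h]

end CoordinatewiseMap

section Layer

open ProbabilityTheory
open Literature.Probability.Percolation (DeterminedBy determinedBy_iff)
open Literature.Probability.LatticeModels (prodBernoulli_real_inter_of_determinedBy)

variable {n : ℕ}

/-- Every unordered pair has a member. [folklore] -/
theorem sigmaLaw_exists_mem (e : Sym2 (Fin n)) : ∃ x, x ∈ e := ⟨e.out.1, Sym2.out_fst_mem e⟩

/-- The one-coordinate computation behind the push-forward: the coin of the pair `e` under
`glue w O`, mapped by `φ_e P := (P ∧ e avoids O) ∨ (e is a non-loop pair inside S)`, is the coin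
of `e` under `glue (kill w O) S`. [folklore] -/
theorem sigmaLaw_map_coin (w : Sym2 (Fin n) → unitInterval) (O S : Finset (Fin n))
    (e : Sym2 (Fin n)) :
    (Ber(True, False, (if (∀ x ∈ e, x ∈ O) ∧ ¬ e.IsDiag then 1 else w e))).map
        (fun P : Prop => (P ∧ ∀ x ∈ e, x ∉ O) ∨ ((∀ x ∈ e, x ∈ S) ∧ ¬ e.IsDiag)) =
      Ber(True, False, (if (∀ x ∈ e, x ∈ S) ∧ ¬ e.IsDiag then 1 else
        if (∃ x ∈ e, x ∈ O) then 0 else w e)) := by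
  rw [map_bernoulliMeasure]
  by_cases hS : (∀ x ∈ e, x ∈ S) ∧ ¬ e.IsDiag
  · have h1 : ((True ∧ ∀ x ∈ e, x ∉ O) ∨ ((∀ x ∈ e, x ∈ S) ∧ ¬ e.IsDiag)) = True :=
      propext (iff_true_intro (Or.inr hS))
    have h2 : ((False ∧ ∀ x ∈ e, x ∉ O) ∨ ((∀ x ∈ e, x ∈ S) ∧ ¬ e.IsDiag)) = True :=
      propext (iff_true_intro (Or.inr hS))
    simp only [h1, h2, if_pos hS, bernoulliMeasure_self_eq_dirac, bernoulliMeasure_one]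
  · by_cases hA : ∀ x ∈ e, x ∉ O
    · have hO : ¬ ((∀ x ∈ e, x ∈ O) ∧ ¬ e.IsDiag) := by
        rintro ⟨h, -⟩
        obtain ⟨x, hx⟩ := sigmaLaw_exists_mem e
        exact hA x hx (h x hx)
      have hO' : ¬ (∃ x ∈ e, x ∈ O) := fun ⟨x, hx, hxO⟩ => hA x hx hxO
      have h1 : ((True ∧ ∀ x ∈ e, x ∉ O) ∨ ((∀ x ∈ e, x ∈ S) ∧ ¬ e.IsDiag)) = True :=
        propext (iff_true_intro (Or.inl ⟨trivial, hA⟩))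
      have h2 : ((False ∧ ∀ x ∈ e, x ∉ O) ∨ ((∀ x ∈ e, x ∈ S) ∧ ¬ e.IsDiag)) = False :=
        propext (iff_false_intro (by rintro (⟨h, -⟩ | h); exacts [h, hS h]))
      simp only [h1, h2, if_neg hO, if_neg hS, if_neg hO']
    · have hO' : ∃ x ∈ e, x ∈ O := by
        by_contra h
        exact hA fun x hx hxO => h ⟨x, hx, hxO⟩
      have h1 : ((True ∧ ∀ x ∈ e, x ∉ O) ∨ ((∀ x ∈ e, x ∈ S) ∧ ¬ e.IsDiag)) = False :=
        propext (iff_false_intro (by rintro (⟨-, h⟩ | h); exacts [hA h, hS h]))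
      have h2 : ((False ∧ ∀ x ∈ e, x ∉ O) ∨ ((∀ x ∈ e, x ∈ S) ∧ ¬ e.IsDiag)) = False :=
        propext (iff_false_intro (by rintro (⟨h, -⟩ | h); exacts [h, hS h]))
      simp only [h1, h2, if_neg hS, if_pos hO', bernoulliMeasure_self_eq_dirac,
        bernoulliMeasure_zero]

/-- **The push-forward of `prodBernoulli (glue w O)` under `Ψ_S` is
`prodBernoulli (glue (kill w O) S)`.** [folklore; Grimmett 1999 §1.3 p. 10] -/
theorem sigmaLaw_map_glue (w : Sym2 (Fin n) → unitInterval) (O S : Finset (Fin n)) :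
    (prodBernoulli (fun e : Sym2 (Fin n) =>
        if (∀ x ∈ e, x ∈ O) ∧ ¬ e.IsDiag then 1 else w e)).map
        (fun ω : BondConfig (Fin n) =>
          ({e | e ∈ ω ∧ ∀ x ∈ e, x ∉ O} ∪ {e | (∀ x ∈ e, x ∈ S) ∧ ¬ e.IsDiag} :
            BondConfig (Fin n))) =
      prodBernoulli (fun e : Sym2 (Fin n) =>
        if (∀ x ∈ e, x ∈ S) ∧ ¬ e.IsDiag then 1 else if (∃ x ∈ e, x ∈ O) then 0 else w e) := by
  have h := sigmaLaw_prodBernoulli_map_coordwise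
    (fun e : Sym2 (Fin n) => if (∀ x ∈ e, x ∈ O) ∧ ¬ e.IsDiag then 1 else w e)
    (fun e : Sym2 (Fin n) =>
      if (∀ x ∈ e, x ∈ S) ∧ ¬ e.IsDiag then 1 else if (∃ x ∈ e, x ∈ O) then 0 else w e)
    (fun (e : Sym2 (Fin n)) (P : Prop) => (P ∧ ∀ x ∈ e, x ∉ O) ∨ ((∀ x ∈ e, x ∈ S) ∧ ¬ e.IsDiag))
    (sigmaLaw_map_coin w O S)
  exact h

/-- The layer event `{layer = S}` is determined by the pairs meeting `O`. [folklore] -/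
theorem sigmaLaw_layer_determinedBy (O S : Finset (Fin n)) :
    DeterminedBy {ω : BondConfig (Fin n) | ∀ x : Fin n, x ∈ S ↔ (x ∉ O ∧ ∃ o ∈ O, s(o, x) ∈ ω)}
      (↑(Finset.univ.filter fun e : Sym2 (Fin n) => ∃ x ∈ e, x ∈ O) : Set (Sym2 (Fin n))) := by
  rw [determinedBy_iff]
  intro ω ω' hωω'
  have key : ∀ o ∈ O, ∀ x : Fin n, s(o, x) ∈ ω ↔ s(o, x) ∈ ω' := by
    intro o ho x
    have he : s(o, x) ∈ (↑(Finset.univ.filter fun e : Sym2 (Fin n) => ∃ x ∈ e, x ∈ O) :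
        Set (Sym2 (Fin n))) := by
      simp only [Finset.coe_filter, Finset.mem_univ, true_and, Set.mem_setOf_eq]
      exact ⟨o, Sym2.mem_mk_left o x, ho⟩
    constructor
    · intro h
      exact ((Set.ext_iff.1 hωω' s(o, x)).1 ⟨h, he⟩).1
    · intro h
      exact ((Set.ext_iff.1 hωω' s(o, x)).2 ⟨h, he⟩).1
  simp only [Set.mem_setOf_eq]
  refine forall_congr' fun x => iff_congr Iff.rfl (and_congr Iff.rfl ?_)
  exact exists_congr fun o => and_congr_right fun ho => key o ho x

/-- `Ψ_S ω` only depends on the pairs of `ω` avoiding `O`. [folklore] -/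
theorem sigmaLaw_psi_eq_of_inter_eq (O S : Finset (Fin n)) {ω ω' : BondConfig (Fin n)}
    (hωω' :
      ω ∩ (↑(Finset.univ.filter fun e : Sym2 (Fin n) => ∃ x ∈ e, x ∈ O) : Set (Sym2 (Fin n)))ᶜ =
      ω' ∩ (↑(Finset.univ.filter fun e : Sym2 (Fin n) => ∃ x ∈ e, x ∈ O) : Set (Sym2 (Fin n)))ᶜ) :
    ({e | e ∈ ω ∧ ∀ x ∈ e, x ∉ O} ∪ {e | (∀ x ∈ e, x ∈ S) ∧ ¬ e.IsDiag} : BondConfig (Fin n)) =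
      {e | e ∈ ω' ∧ ∀ x ∈ e, x ∉ O} ∪ {e | (∀ x ∈ e, x ∈ S) ∧ ¬ e.IsDiag} := by
  have key : ∀ e : Sym2 (Fin n), (∀ x ∈ e, x ∉ O) → (e ∈ ω ↔ e ∈ ω') := by
    intro e he
    have hec : e ∈ (↑(Finset.univ.filter fun e : Sym2 (Fin n) => ∃ x ∈ e, x ∈ O) :
        Set (Sym2 (Fin n)))ᶜ := by
      simp only [Set.mem_compl_iff, Finset.coe_filter, Finset.mem_univ, true_and, Set.mem_setOf_eq,
        not_exists, not_and]
      exact he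
    constructor
    · intro h
      exact ((Set.ext_iff.1 hωω' e).1 ⟨h, hec⟩).1
    · intro h
      exact ((Set.ext_iff.1 hωω' e).2 ⟨h, hec⟩).1
  ext e
  simp only [Set.mem_union, Set.mem_setOf_eq]
  constructor
  · rintro (⟨h, he⟩ | h)
    · exact Or.inl ⟨(key e he).1 h, he⟩
    · exact Or.inr h
  · rintro (⟨h, he⟩ | h)
    · exact Or.inl ⟨(key e he).2 h, he⟩
    · exact Or.inr h

/-- **stub_sigmaLaw — the law of the layer decomposition (domain Markov + glue/kill
pushforward).**  Under `prodBernoulli (glue w O)` the layer event `{layer = S}` is determined by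
the pairs MEETING `O`, while `Ψ_S ω` is a function of the pairs AVOIDING `O`; hence they are
independent (`prodBernoulli_real_inter_of_determinedBy`), and the law of `Ψ_S` is
`prodBernoulli (glue (kill w O) S)` (pairs meeting `O` ↦ closed = weight 0, non-loop pairs inside
`S` ↦ open = weight 1, other pairs keep their weight; coordinatewise push-forward of the product
of coins).  So for every event `E`:
`μ_{G/O}({layer = S} ∩ Ψ_S⁻¹ E) = μ_{G/O}{layer = S} · μ_{(G∖O)/S}(E)`.
[folklore; Grimmett 1999 §1.3, §2.2] -/
theorem stub_sigmaLaw :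
    ∀ (n : ℕ) (w : Sym2 (Fin n) → unitInterval) (O S : Finset (Fin n))
      (E : Set (BondConfig (Fin n))),
      (prodBernoulli (fun e : Sym2 (Fin n) =>
          if (∀ x ∈ e, x ∈ O) ∧ ¬ e.IsDiag then 1 else w e)).real
          ({ω | ∀ x : Fin n, x ∈ S ↔ (x ∉ O ∧ ∃ o ∈ O, s(o, x) ∈ ω)} ∩
            {ω | ({e | e ∈ ω ∧ ∀ x ∈ e, x ∉ O} ∪ {e | (∀ x ∈ e, x ∈ S) ∧ ¬ e.IsDiag}) ∈ E}) =
        (prodBernoulli (fun e : Sym2 (Fin n) =>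
            if (∀ x ∈ e, x ∈ O) ∧ ¬ e.IsDiag then 1 else w e)).real
            {ω | ∀ x : Fin n, x ∈ S ↔ (x ∉ O ∧ ∃ o ∈ O, s(o, x) ∈ ω)} *
          (prodBernoulli (fun e : Sym2 (Fin n) =>
            if (∀ x ∈ e, x ∈ S) ∧ ¬ e.IsDiag then 1 else
              if (∃ x ∈ e, x ∈ O) then 0 else w e)).real E := by
  intro n w O S E
  -- independence: layer event (pairs meeting `O`) vs. `Ψ_S⁻¹ E` (pairs avoiding `O`)
  have hΨdet : DeterminedBy
      {ω : BondConfig (Fin n) |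
        ({e | e ∈ ω ∧ ∀ x ∈ e, x ∉ O} ∪ {e | (∀ x ∈ e, x ∈ S) ∧ ¬ e.IsDiag}) ∈ E}
      (↑(Finset.univ.filter fun e : Sym2 (Fin n) => ∃ x ∈ e, x ∈ O) : Set (Sym2 (Fin n)))ᶜ := by
    rw [determinedBy_iff]
    intro ω ω' hωω'
    simp only [Set.mem_setOf_eq]
    rw [sigmaLaw_psi_eq_of_inter_eq O S hωω']
  rw [prodBernoulli_real_inter_of_determinedBy _ _ (sigmaLaw_layer_determinedBy O S) hΨdet
    MeasurableSet.of_discrete MeasurableSet.of_discrete]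
  congr 1
  -- the law of `Ψ_S`
  have hmeas : Measurable fun ω : BondConfig (Fin n) =>
      ({e | e ∈ ω ∧ ∀ x ∈ e, x ∉ O} ∪ {e | (∀ x ∈ e, x ∈ S) ∧ ¬ e.IsDiag} : BondConfig (Fin n)) :=
    Measurable.of_discrete
  rw [measureReal_def, measureReal_def, ← sigmaLaw_map_glue w O S,
    Measure.map_apply hmeas MeasurableSet.of_discrete]
  rfl

end Layer

end

end Summit.CriticalPhenomena.PercolationContinuityZ3.Theorems
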